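/-
Origin: expansion seat `planner-pub-hodgecm-pv14-g5-0`, handover #9 2026-08-18T10:44:51Z (`HOME/pub-hodgecm-pv14-g5/lean/Pv14g5/WeilThetaModelHeisenbergWeylLattice.lean`, md5 291fcacb, 263 lines);
landed by the gen-7 packager in gate run 28 as `HodgeCM/Automorphic/WeilThetaModelHeisenbergWeylLattice.lean` (import ^import Pv14g5\.→import HodgeCM.Automorphic. ×2).
-/
/-
Origin: HOME/pub-hodgecm-pv14-g5/lean/Pv14g5/WeilThetaModelHeisenbergWeylLattice.lean — session planner-pub-hodgecm-pv14-g5-0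
(unit pub-hodgecm-pv14-g5, DAG-node prover #14 gen 5).  Intended final place:
`HodgeCM/Automorphic/WeilThetaModelHeisenbergWeylLattice.lean` (namespace `HodgeCM.SchwartzWeil`).
PACKAGER: rewrite `import Pv14g5.WeilThetaModelHeisenbergWeyl` to `import HodgeCM.Automorphic.WeilThetaModelHeisenbergWeyl`
(this seat's #8) and `import Pv14g5.WeilThetaModelHeisenbergLattice` to
`import HodgeCM.Automorphic.WeilThetaModelHeisenbergLattice` (this seat's #7).
Asserts nothing (no `axiom`, no new constants).
-/
import Summits.HodgeConjecture.HodgeCM.Automorphic.WeilThetaModelHeisenbergWeyl_2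
import Summits.HodgeConjecture.HodgeCM.Automorphic.WeilThetaModelHeisenbergLattice

/-!
# `⟨arith, σ⟩` is a discrete cocompact subgroup of `Heis V ⋊ ⟨σ⟩`: the extended model inhabits the lattice junction

For a SELF-DUAL full lattice `L ⊂ V` and `m ≠ 0`:

* `HeisW V m hm ≃ₜ Heis V × ℤ`; `T2`, locally compact, second countable;
* `arithW_eq_leftArith : arithW = {x | x.left ∈ arith}` (self-duality: `σ` preserves `arith`, #6), hence
  `discreteTopology_arithW`; `inr n ∈ arithW` always, hence the continuous surjection
  `Heis V ⧸ arith → HeisW ⧸ arithW` and `CompactSpace (HeisW ⧸ arithW)` (from #7);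
* `heisenbergWeylLatticeModel hL : CocompactLatticeModel` and #8's model typed over the pair of lattice models
  (`heisenbergWeylModelOverLattice`) — the type of prl1-g4's `LatticeModelThetaData.wm`; the hypothesis-free
  standard instance `heisenbergWeylLatticeModelStd n m` (`ℝⁿ ⊃ ℤⁿ`).
-/

set_option autoImplicit false

noncomputable section

open Topology MeasureTheory
open scoped RealInnerProductSpace FourierTransform SchwartzMap

namespace HodgeCM
namespace SchwartzWeil

/-! ## 1. Topology of `HeisW` -/

namespace HeisW

variable {V : Type*} [NormedAddCommGroup V] [InnerProductSpace ℝ V] {m : ℤ} {hm : m ≠ 0}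

/-- `HeisW V m hm ≃ₜ Heis V × ℤ`. -/
def homeomorphProd : HeisW V m hm ≃ₜ Heis V × Multiplicative ℤ where
  toFun := toProd
  invFun p := ⟨p.1, p.2⟩
  left_inv _ := rfl
  right_inv _ := rfl
  continuous_toFun := continuous_toProd
  continuous_invFun := continuous_mk continuous_fst continuous_snd

/-- (Ported verbatim from the HodgeCMPerL package; no docstring in the source.) -/
@[simp] theorem homeomorphProd_apply (x : HeisW V m hm) : homeomorphProd x = (x.left, x.right) := rfl

/-- (Ported verbatim from the HodgeCMPerL package; no docstring in the source.) -/
theorem isClosedEmbedding_toProd : IsClosedEmbedding (toProd : HeisW V m hm → Heis V × Multiplicative ℤ) :=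
  (homeomorphProd (V := V) (m := m) (hm := hm)).isClosedEmbedding

/-- (Ported verbatim from the HodgeCMPerL package; no docstring in the source.) -/
instance instT2Space : T2Space (HeisW V m hm) :=
  (isClosedEmbedding_toProd (V := V) (m := m) (hm := hm)).isEmbedding.t2Space

/-- (Ported verbatim from the HodgeCMPerL package; no docstring in the source.) -/
instance instLocallyCompactSpace [LocallyCompactSpace V] : LocallyCompactSpace (HeisW V m hm) :=
  (isClosedEmbedding_toProd (V := V) (m := m) (hm := hm)).locallyCompactSpace

/-- (Ported verbatim from the HodgeCMPerL package; no docstring in the source.) -/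
instance instSecondCountableTopology [SecondCountableTopology V] : SecondCountableTopology (HeisW V m hm) :=
  (isClosedEmbedding_toProd (V := V) (m := m) (hm := hm)).isInducing.secondCountableTopology

/-- (Ported verbatim from the HodgeCMPerL package; no docstring in the source.) -/
theorem continuous_inl : Continuous fun h : Heis V => (SemidirectProduct.inl h : HeisW V m hm) :=
  continuous_mk continuous_id continuous_const

end HeisW

/-! ## 2. `arithW` for a self-dual lattice -/

section ArithW

variable (V : Type) [NormedAddCommGroup V] [InnerProductSpace ℝ V] (L : Submodule ℤ V) (m : ℤ) (hm : m ≠ 0)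

/-- `inr n = σⁿ ∈ arithW` (always). -/
theorem inr_mem_arithW (n : Multiplicative ℤ) : (SemidirectProduct.inr n : HeisW V m hm) ∈ arithW V L m hm := by
  refine Subgroup.mem_sup_right (Subgroup.mem_zpowers_iff.mpr ⟨n.toAdd, ?_⟩)
  rw [map_one, one_mul, ← map_zpow, ← ofAdd_zsmul, smul_eq_mul, mul_one, ofAdd_toAdd]

/-- `x ∈ arithW` as soon as `x.left ∈ arith` (always). -/
theorem mem_arithW_of_left_mem {x : HeisW V m hm} (hx : x.left ∈ arith V L m) : x ∈ arithW V L m hm := by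
  rw [← SemidirectProduct.inl_left_mul_inr_right x]
  exact (arithW V L m hm).mul_mem (inl_mem_arithW V L m hm hx) (inr_mem_arithW V L m hm x.right)

variable [FiniteDimensional ℝ V] [DiscreteTopology L] [IsZLattice ℝ L]

/-- For a self-dual lattice every `σⁿ` preserves `arith` (#6 `weyl_mem_arith_of_dualLattice_eq`). -/
theorem weylAction_mem_arith (hL : PoissonSummation.dualLattice L = L) (n : Multiplicative ℤ) {γ : Heis V}
    (hγ : γ ∈ arith V L m) : Heis.weylAction m hm n γ ∈ arith V L m := by
  rw [Heis.weylAction_apply]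
  refine zpow_induction_left (g := Heis.weylAut m hm)
    (P := fun e : MulAut (Heis V) => ∀ γ ∈ arith V L m, e γ ∈ arith V L m) (fun γ h => h)
    (fun e he γ hγ => ?_) (fun e he γ hγ => ?_) n.toAdd γ hγ
  · rw [MulAut.mul_apply, Heis.weylAut_apply]
    exact weyl_mem_arith_of_dualLattice_eq V L m hL hm (he γ hγ)
  · rw [MulAut.mul_apply, MulAut.inv_apply, Heis.weylAut_symm_apply]
    exact weyl_mem_arith_of_dualLattice_eq V L m hL hm (weyl_mem_arith_of_dualLattice_eq V L m hL hm
      (weyl_mem_arith_of_dualLattice_eq V L m hL hm (he γ hγ)))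

/-- The subgroup `{x | x.left ∈ arith}` of `HeisW` (a subgroup because `σ` preserves `arith`). -/
def leftArith (hL : PoissonSummation.dualLattice L = L) : Subgroup (HeisW V m hm) where
  carrier := {x | x.left ∈ arith V L m}
  one_mem' := by
    show (1 : HeisW V m hm).left ∈ arith V L m
    rw [SemidirectProduct.one_left]
    exact (arith V L m).one_mem
  mul_mem' {x y} hx hy := by
    show (x * y).left ∈ arith V L m
    rw [SemidirectProduct.mul_left]
    exact (arith V L m).mul_mem hx (weylAction_mem_arith V L m hm hL _ hy)
  inv_mem' {x} hx := by
    show x⁻¹.left ∈ arith V L m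
    rw [SemidirectProduct.inv_left]
    exact weylAction_mem_arith V L m hm hL _ ((arith V L m).inv_mem hx)

/-- (Ported verbatim from the HodgeCMPerL package; no docstring in the source.) -/
theorem mem_leftArith (hL : PoissonSummation.dualLattice L = L) {x : HeisW V m hm} :
    x ∈ leftArith V L m hm hL ↔ x.left ∈ arith V L m :=
  Iff.rfl

/-- **`arithW = {x | x.left ∈ arith} = arith ⋊ ⟨σ⟩`** for a self-dual lattice. -/
theorem arithW_eq_leftArith (hL : PoissonSummation.dualLattice L = L) : arithW V L m hm = leftArith V L m hm hL := by
  refine le_antisymm (sup_le (Subgroup.map_le_iff_le_comap.mpr fun γ hγ => ?_) ?_)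
    fun x hx => mem_arithW_of_left_mem V L m hm hx
  · show (SemidirectProduct.inl γ : HeisW V m hm).left ∈ arith V L m
    rwa [SemidirectProduct.left_inl]
  · rw [Subgroup.zpowers_le, map_one, one_mul]
    show (SemidirectProduct.inr (Multiplicative.ofAdd (1 : ℤ)) : HeisW V m hm).left ∈ arith V L m
    rw [SemidirectProduct.left_inr]
    exact (arith V L m).one_mem

/-- (Ported verbatim from the HodgeCMPerL package; no docstring in the source.) -/
theorem left_mem_arith_of_mem_arithW (hL : PoissonSummation.dualLattice L = L) {x : HeisW V m hm}
    (hx : x ∈ arithW V L m hm) : x.left ∈ arith V L m := by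
  rwa [arithW_eq_leftArith V L m hm hL] at hx

/-- **`arithW` is DISCRETE** (self-dual full lattice `L`, `m ≠ 0`): it embeds continuously into the discrete
`arith × ℤ` (#7). -/
theorem discreteTopology_arithW (hL : PoissonSummation.dualLattice L = L) : DiscreteTopology (arithW V L m hm) := by
  haveI : NeZero m := ⟨hm⟩
  refine DiscreteTopology.of_continuous_injective
    (f := fun x : arithW V L m hm =>
      ((⟨x.1.left, left_mem_arith_of_mem_arithW V L m hm hL x.2⟩ : arith V L m), x.1.right)) ?_ ?_
  · exact ((HeisW.continuous_left.comp continuous_subtype_val).subtype_mk _).prodMk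
      (HeisW.continuous_right.comp continuous_subtype_val)
  · intro x y h
    simp only [Prod.mk.injEq, Subtype.mk.injEq] at h
    exact Subtype.ext (SemidirectProduct.ext h.1 h.2)

/-- The comparison map `Heis V ⧸ arith → HeisW ⧸ arithW`, `h·arith ↦ (h, 1)·arithW`. -/
def quotientMapW : Heis V ⧸ arith V L m → HeisW V m hm ⧸ arithW V L m hm :=
  Quotient.lift (fun h : Heis V => (QuotientGroup.mk (SemidirectProduct.inl h) : HeisW V m hm ⧸ arithW V L m hm))
    fun a b hab => QuotientGroup.eq.mpr (by
      rw [← map_inv, ← map_mul]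
      exact inl_mem_arithW V L m hm (QuotientGroup.leftRel_apply.mp hab))

omit [FiniteDimensional ℝ V] [DiscreteTopology L] [IsZLattice ℝ L] in
/-- (Ported verbatim from the HodgeCMPerL package; no docstring in the source.) -/
theorem quotientMapW_mk (h : Heis V) :
    quotientMapW V L m hm (QuotientGroup.mk h) = QuotientGroup.mk (SemidirectProduct.inl h) := rfl

omit [FiniteDimensional ℝ V] [DiscreteTopology L] [IsZLattice ℝ L] in
/-- (Ported verbatim from the HodgeCMPerL package; no docstring in the source.) -/
theorem continuous_quotientMapW : Continuous (quotientMapW V L m hm) :=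
  (QuotientGroup.continuous_mk.comp HeisW.continuous_inl).quotient_lift _

omit [FiniteDimensional ℝ V] [DiscreteTopology L] [IsZLattice ℝ L] in
/-- (Ported verbatim from the HodgeCMPerL package; no docstring in the source.) -/
theorem surjective_quotientMapW : Function.Surjective (quotientMapW V L m hm) := by
  intro q
  induction q using QuotientGroup.induction_on with
  | H x =>
    refine ⟨QuotientGroup.mk x.left, ?_⟩
    rw [quotientMapW_mk, QuotientGroup.eq]
    refine mem_arithW_of_left_mem V L m hm ?_
    rw [← map_inv, SemidirectProduct.mul_left, SemidirectProduct.left_inl, SemidirectProduct.right_inl, map_one,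
      MulAut.one_apply, inv_mul_cancel]
    exact (arith V L m).one_mem

/-- **`HeisW ⧸ arithW` is COMPACT** (a continuous image of the Heisenberg nilmanifold of #7). -/
instance instCompactSpaceQuotientArithW [NeZero m] : CompactSpace (HeisW V m hm ⧸ arithW V L m hm) :=
  ⟨by
    rw [← Set.range_eq_univ.mpr (surjective_quotientMapW V L m hm)]
    exact isCompact_range (continuous_quotientMapW V L m hm)⟩

end ArithW

/-! ## 3. The lattice models -/

section Models

variable (V : Type) [NormedAddCommGroup V] [InnerProductSpace ℝ V] [FiniteDimensional ℝ V]
  (L : Submodule ℤ V) [DiscreteTopology L] [IsZLattice ℝ L] (m : ℤ) [NeZero m]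

/-- **`(Heis V ⋊ ⟨σ⟩, ⟨arith, σ⟩)` is a cocompact lattice model** (self-dual full `L`, `m ≠ 0`). -/
def heisenbergWeylLatticeModel (hL : PoissonSummation.dualLattice L = L) : CocompactLatticeModel :=
  haveI := discreteTopology_arithW V L m (NeZero.ne m) hL
  { G := HeisW V m (NeZero.ne m)
    Γ := arithW V L m (NeZero.ne m) }

/-- (Ported verbatim from the HodgeCMPerL package; no docstring in the source.) -/
@[simp] theorem heisenbergWeylLatticeModel_G (hL : PoissonSummation.dualLattice L = L) :
    (heisenbergWeylLatticeModel V L m hL).G = HeisW V m (NeZero.ne m) := rfl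

/-- (Ported verbatim from the HodgeCMPerL package; no docstring in the source.) -/
@[simp] theorem heisenbergWeylLatticeModel_Γ (hL : PoissonSummation.dualLattice L = L) :
    (heisenbergWeylLatticeModel V L m hL).Γ = arithW V L m (NeZero.ne m) := rfl

/-- Its compact Haar quotient model (`QuotientModel.ofLattice`: Haar measure, fundamental domain — constructed). -/
def heisenbergWeylQuotientModel (hL : PoissonSummation.dualLattice L = L) : QuotientModel :=
  (heisenbergWeylLatticeModel V L m hL).toQuotientModel

/-- (Ported verbatim from the HodgeCMPerL package; no docstring in the source.) -/
theorem heisenbergWeylQuotientModel_G (hL : PoissonSummation.dualLattice L = L) :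
    (heisenbergWeylQuotientModel V L m hL).G = HeisW V m (NeZero.ne m) := rfl

variable [MeasurableSpace V] [BorelSpace V]

/-- **#8's extended model, typed over the two cocompact lattice models** — the type of `LatticeModelThetaData.wm` at
`(latU, lat) := (heisenbergWeylLatticeModel V L m hL, circleLatticeModel Γ)`. -/
def heisenbergWeylModelOverLattice (hL : PoissonSummation.dualLattice L = L) (Γ : Subgroup Circle) [Finite Γ]
    (hΓ : ∀ u ∈ Γ, u ^ m = 1) :
    WeilThetaModel (heisenbergWeylLatticeModel V L m hL).toQuotientModel.G
      (heisenbergWeylLatticeModel V L m hL).toQuotientModel.Γ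
      (circleLatticeModel Γ).toQuotientModel.G (circleLatticeModel Γ).toQuotientModel.Γ :=
  heisenbergWeylModel V L m (NeZero.ne m) hL Γ hΓ

/-- (Ported verbatim from the HodgeCMPerL package; no docstring in the source.) -/
theorem heisenbergWeylModelOverLattice_eq (hL : PoissonSummation.dualLattice L = L) (Γ : Subgroup Circle)
    [Finite Γ] (hΓ : ∀ u ∈ Γ, u ^ m = 1) :
    heisenbergWeylModelOverLattice V L m hL Γ hΓ = heisenbergWeylModel V L m (NeZero.ne m) hL Γ hΓ := rfl

/-- (Ported verbatim from the HodgeCMPerL package; no docstring in the source.) -/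
theorem heisenbergWeylModelOverLattice_θ_ne_zero (hL : PoissonSummation.dualLattice L = L) (Γ : Subgroup Circle)
    [Finite Γ] (hΓ : ∀ u ∈ Γ, u ^ m = 1) :
    ∃ Φ, (heisenbergWeylModelOverLattice V L m hL Γ hΓ).θ Φ (QuotientGroup.mk 1, QuotientGroup.mk 1) ≠ 0 :=
  heisenbergWeylModel_θ_ne_zero V L m (NeZero.ne m) hL Γ hΓ

end Models

/-! ## 4. The standard instance `ℝⁿ ⊃ ℤⁿ` -/

section Standard

/-- **The standard extended Heisenberg lattice model** `(Heis ℝⁿ ⋊ ⟨σ⟩, ⟨arith ℤⁿ m, σ⟩)` — no hypotheses left. -/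
def heisenbergWeylLatticeModelStd (n : ℕ) (m : ℤ) [NeZero m] : CocompactLatticeModel :=
  heisenbergWeylLatticeModel (EuclideanSpace ℝ (Fin n)) (Submodule.span ℤ (Set.range (PiLp.basisFun 2 ℝ (Fin n)))) m
    (SelfDual.dualLattice_zn n)

/-- (Ported verbatim from the HodgeCMPerL package; no docstring in the source.) -/
theorem heisenbergWeylLatticeModelStd_G (n : ℕ) (m : ℤ) [NeZero m] :
    (heisenbergWeylLatticeModelStd n m).G = HeisW (EuclideanSpace ℝ (Fin n)) m (NeZero.ne m) := rfl

/-- … and #8's model over it, acting group `Circle ⊇ Γ = ⊥`. -/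
def heisenbergWeylModelStdOverLattice (n : ℕ) (m : ℤ) [NeZero m] :
    WeilThetaModel (heisenbergWeylLatticeModelStd n m).toQuotientModel.G
      (heisenbergWeylLatticeModelStd n m).toQuotientModel.Γ
      (circleLatticeModel (⊥ : Subgroup Circle)).toQuotientModel.G
      (circleLatticeModel (⊥ : Subgroup Circle)).toQuotientModel.Γ :=
  heisenbergWeylModelOverLattice (EuclideanSpace ℝ (Fin n)) (Submodule.span ℤ (Set.range (PiLp.basisFun 2 ℝ (Fin n))))
    m (SelfDual.dualLattice_zn n) ⊥ fun u hu => by rw [Subgroup.mem_bot.mp hu, one_zpow]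

/-- (Ported verbatim from the HodgeCMPerL package; no docstring in the source.) -/
theorem heisenbergWeylModelStdOverLattice_θ_ne_zero (n : ℕ) (m : ℤ) [NeZero m] :
    ∃ Φ, (heisenbergWeylModelStdOverLattice n m).θ Φ (QuotientGroup.mk 1, QuotientGroup.mk 1) ≠ 0 :=
  heisenbergWeylModelOverLattice_θ_ne_zero _ _ _ _ _ _

end Standard

end SchwartzWeil
end HodgeCM

end
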